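import Summits.QuantumFields.BalabanUV.Beta.WilsonBiStencilWardZ
import Summits.QuantumFields.BalabanUV.Beta.WilsonJetReflection2Entry

/-!
# `BalabanUV.Beta.WilsonJetReflection2Trace` — binder row D1, W-side leaf (W-0W), stage S3a: **THE COLOUR TRACES OF THE BLOCKS OF THE
# ENTRYWISE `(2,2)` AXIS-REFLECTION LAW** (β sub-cell, row BETA-an3, lineage an3 gen 32)

HONEST FRAMING (cell charter, verbatim): «discharging BetaPertH makes Balaban's UV stability UNCONDITIONAL — a real
constructive-QFT result; it is NOT the continuum limit and NOT the Clay problem.»  Neutral finite algebra ([folklore]): colour traces over an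
orthonormal complete generator family `τ` of `Mat_N(ℂ)` (an3's `ColourTrace.Complete` / `TrOrthonormal`), no statement of Bałaban's papers, no
`[cite:]`, no `def`; instantiates no binder of the wall.  NOT D1, NOT `BetaPertH`, NOT continuum, NOT Clay.

WHAT.  `WilsonJetReflection2Entry.jet22_pull_entry_colour` (S2) is the `(2,2)` axis-reflection law entrywise with colour, for the doubly rotated
letter family `T = rotFam (rotFam t Y₂ ![]) Y₁ ![Y₁, Y₂]`.  Here, at `t = gen τ`, `Yᵢ = gen τ cᵢ`, the blocks are TRACED over the fluctuation colour
diagonal `a ↦ (inl (inl a), inl (inl a))`: §1 the two-bond blocks trace to the traced table `bondPairTab … (w22 N)` times `[c₁ = c₂]` (the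
double-family twin of leaf-09's `WilsonBiStencilWardTrace.sum_wilsonVertex₂_spare₀₁_diag`; their `wilsonVertex₂_rotFam_spare_apply` and
`cwordV_rotFam_inl` are generic in the base family); §2 the four first-order colour matrices `adM` between the fluctuation letter and a rotated
letter trace to leaf-09's two conjugation numbers `∓2N²·[c₁ = c₂]` (`sum_rntr_conj₁/₂`, literally); §3 the two curl–curl colour numbers trace to
`−2N²·[c₁ = c₂]` (the product of two commutators, via `rntr_mul_br_br`) and `+4N²·[c₁ = c₂]` (the symmetrised double commutator, by cyclicity);
§4 **`jet22_pull_traced`** — THE TRACED LAW at one background colour `c₁ = c₂ = c`: the entry law summed over the fluctuation colour diagonal,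
every block in closed form — the slot-symmetrised traced two-bond table `bondPairTab … (w22 N)` at the REFLECTED bonds and legs (signs `sgn α`)
against the same at the original bonds, four cut first-order colourless stencils `wilsonStencil₀` with weights `∓2N²`, and the two curl–curl
cuts with weights `4N²`, `−2N²` (the pattern of leaf-09's `bgWard22_traced_table`; constants as the kernel fixed them);
§5 **`jet22_pull_traced_wsym22`** — THE SAME LAW IN THE PACKED CURRENCY: the four-term symmetrisation is the table of `wsym22 N` (leaf-09's
`WilsonBiStencilWardZ.bondPairTab_fourTerm` + `symTab_w22`), the first-order cuts pair into gen-29's antisymmetrised stencil `S₀A`: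
`s₁s₂·s_μs_ν·BPT(û₁κ₁;û₂κ₂;wsym22)(ρ̄x,μ)(ρ̄z,ν) − BPT(u₁κ₁;u₂κ₂;wsym22)(x,μ)(z,ν) + 4N²·Σ(±cut·S₀A) − 2N²·Σ(cut·curlCurl)`
`+ 2N²·Σ(cut·curlCurl) = 0`
— reflected table = table + field-supported contact terms, on every finite lattice (the shape of the owner's socket `hQ` of
`SecondOrderZeroLaw.quarticZero_bref_of_laws`, before transport to `ℤ^{d+1}`).
Provenance: β sub-cell, unit beta-an3 gen 32, 2026-08-20 (v1); no existing file touched.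
-/

namespace Summit.QuantumFields.BalabanUV.Beta.WilsonJetReflection2Trace

open Finset
open scoped BigOperators Matrix
open Literature.MathematicalPhysics.QuantumFieldTheory.Balaban1983to89.Beta
open Literature.MathematicalPhysics.QuantumFieldTheory.Balaban1983to89.Beta.SpinTable (br)
open Literature.MathematicalPhysics.QuantumFieldTheory.Balaban1983to89.Beta.ColourTrace (Complete TrOrthonormal)
open Literature.MathematicalPhysics.QuantumFieldTheory.Balaban1983to89.Beta.PlaquetteVertex (adM adM_apply rntr rntr_comm gen)
open Literature.MathematicalPhysics.QuantumFieldTheory.Balaban1983to89.Beta.PlaquetteVertex2Trace (w22)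
open Literature.MathematicalPhysics.QuantumFieldTheory.Balaban1983to89.Beta.WilsonVertex2Kron (cwordV wilsonVertex₂ bondPairTab sum_cwordV_diag
  bondPairTab_w22_eq_sum)
open Literature.MathematicalPhysics.QuantumFieldTheory.Balaban1983to89.Beta.WilsonVertexKron (wilsonStencil₀ wilsonVertex₁_apply_eq_mul)
open Summit.QuantumFields.BalabanUV.Beta.WilsonStencilDivergence (curlCurl)
open Literature.MathematicalPhysics.QuantumFieldTheory.Balaban1983to89.Beta.WilsonVertex2Sym (symTab wsym22 symTab_w22 bondPairTab_symTab_swap)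
open Summit.QuantumFields.BalabanUV.Beta.WilsonReflectionFrame (sgn rsite S₀A)
open Summit.QuantumFields.BalabanUV.Beta.WilsonBiStencilWardZ (bondPairTab_fourTerm)
open Summit.QuantumFields.BalabanUV.Beta.WilsonBiStencilWardFrame
open Summit.QuantumFields.BalabanUV.Beta.WilsonJetReflection2Entry (jet22_pull_entry_colour)
open Summit.QuantumFields.BalabanUV.Beta.WilsonBiStencilWardTrace (wilsonVertex₂_rotFam_spare_apply cwordV_rotFam_inl sum_rntr_conj₁
  sum_rntr_conj₂ rntr_mul_br_br)

section Traces

open scoped Matrix.Norms.Operator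

variable {N : ℕ} {C : Type*} [Fintype C] [DecidableEq C]
variable {Λ : Type*} [DecidableEq Λ] [AddCommGroup Λ] {D : Type*} [Fintype D] [DecidableEq D]

/-! ## §1 The two-bond blocks of the doubly rotated family trace to the traced table -/

/-- [folklore] **THE COLOUR TRACE OF THE `(2,2)` BLOCK `(⋆0, ⋆1)` OF THE DOUBLY ROTATED FAMILY IS THE TRACED TABLE `w22 N`**:
`Σ_a wV₂ T (u₁,⋆0,κ₁) (u₂,⋆1,κ₂) ((x,a,α),(z,a,β)) = [c₁ = c₂]·bondPairTab (w22 N) (u₁κ₁;u₂κ₂) (x,α) (z,β)` for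
`T = rotFam (rotFam (gen τ) Yi ![]) Yo ![gen τ c₁, gen τ c₂]`, fluctuation legs `inl (inl a)`. -/
theorem sum_wilsonVertex₂_dspare₀₁_diag {τ : C → Matrix (Fin N) (Fin N) ℂ} (hτ : Complete τ) (ho : TrOrthonormal τ) (hN : N ≠ 0)
    (Yo Yi : Matrix (Fin N) (Fin N) ℂ) (c₁ c₂ : C) (e : D → Λ) (u₁ : Λ) (κ₁ : D) (u₂ : Λ) (κ₂ : D) (x : Λ) (α : D) (z : Λ) (β : D) :
    ∑ a, wilsonVertex₂ rntr (rotFam (rotFam (gen τ) Yi ![]) Yo ![gen τ c₁, gen τ c₂]) e (u₁, (Sum.inr (Sum.inr 0), κ₁))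
        (u₂, (Sum.inr (Sum.inr 1), κ₂)) (x, (Sum.inl (Sum.inl a), α)) (z, (Sum.inl (Sum.inl a), β)) =
      if c₁ = c₂ then bondPairTab e u₁ κ₁ u₂ κ₂ (w22 N) (x, α) (z, β) else 0 := by
  simp only [wilsonVertex₂_rotFam_spare_apply, cwordV_rotFam_inl, Matrix.cons_val_zero, Matrix.cons_val_one]
  rw [Finset.sum_comm]
  simp only [← Finset.sum_mul, sum_cwordV_diag hτ ho hN]
  split_ifs with h
  · rw [bondPairTab_w22_eq_sum, Matrix.sum_apply]
    exact Finset.sum_congr rfl fun w _ => by rw [Matrix.smul_apply, smul_eq_mul]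
  · simp

/-- [folklore] the same for the block `(⋆1, ⋆0)` (background slots exchanged). -/
theorem sum_wilsonVertex₂_dspare₁₀_diag {τ : C → Matrix (Fin N) (Fin N) ℂ} (hτ : Complete τ) (ho : TrOrthonormal τ) (hN : N ≠ 0)
    (Yo Yi : Matrix (Fin N) (Fin N) ℂ) (c₁ c₂ : C) (e : D → Λ) (u₁ : Λ) (κ₁ : D) (u₂ : Λ) (κ₂ : D) (x : Λ) (α : D) (z : Λ) (β : D) :
    ∑ a, wilsonVertex₂ rntr (rotFam (rotFam (gen τ) Yi ![]) Yo ![gen τ c₁, gen τ c₂]) e (u₁, (Sum.inr (Sum.inr 1), κ₁))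
        (u₂, (Sum.inr (Sum.inr 0), κ₂)) (x, (Sum.inl (Sum.inl a), α)) (z, (Sum.inl (Sum.inl a), β)) =
      if c₁ = c₂ then bondPairTab e u₁ κ₁ u₂ κ₂ (w22 N) (x, α) (z, β) else 0 := by
  simp only [wilsonVertex₂_rotFam_spare_apply, cwordV_rotFam_inl, Matrix.cons_val_zero, Matrix.cons_val_one]
  rw [Finset.sum_comm]
  simp only [← Finset.sum_mul, sum_cwordV_diag hτ ho hN]
  by_cases hc : c₁ = c₂
  · subst hc
    simp only [if_true]
    rw [bondPairTab_w22_eq_sum, Matrix.sum_apply]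
    exact Finset.sum_congr rfl fun w _ => by rw [Matrix.smul_apply, smul_eq_mul]
  · have hc' : ¬c₂ = c₁ := fun h => hc h.symm
    simp [hc, hc']

/-! ## §2 The four first-order colour matrices trace to the conjugation numbers -/

/-- [folklore] **`A₁`-TYPE TRACE**: the colour matrix of `ad Y₁` between the fluctuation letter and the inner rotated letter `[Y₂, t]`,
traced: `Σ_a adM T Y₁ (a) ([Y₂,t]_a) = Σ_a rntr(t_{c₁}·[t_a,[t_{c₂},t_a]]) = [c₂ = c₁]·(−2N²)` (leaf-09's `sum_rntr_conj₁`). -/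
theorem sum_adM_fluct_inner {τ : C → Matrix (Fin N) (Fin N) ℂ} (hτ : Complete τ) (ho : TrOrthonormal τ) (hN : N ≠ 0)
    (y : Fin 2 → Matrix (Fin N) (Fin N) ℂ) (c₁ c₂ : C) :
    ∑ a, adM rntr (rotFam (rotFam (gen τ) (gen τ c₂) ![]) (gen τ c₁) y) (gen τ c₁) (Sum.inl (Sum.inl a)) (Sum.inl (Sum.inr (Sum.inl a))) =
      if c₂ = c₁ then -(2 * (N : ℝ) ^ 2) else 0 := by
  simp only [adM_apply, rotFam_inl, rotFam_inr_inl]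
  exact sum_rntr_conj₁ hτ ho hN c₂ c₁

/-- [folklore] **`A₂`-TYPE TRACE** (the row twin): `Σ_a adM T Y₁ ([Y₂,t]_a) (a) = Σ_a rntr(t_{c₁}·[[t_{c₂},t_a],t_a]) = [c₂ = c₁]·(2N²)`. -/
theorem sum_adM_inner_fluct {τ : C → Matrix (Fin N) (Fin N) ℂ} (hτ : Complete τ) (ho : TrOrthonormal τ) (hN : N ≠ 0)
    (y : Fin 2 → Matrix (Fin N) (Fin N) ℂ) (c₁ c₂ : C) :
    ∑ a, adM rntr (rotFam (rotFam (gen τ) (gen τ c₂) ![]) (gen τ c₁) y) (gen τ c₁) (Sum.inl (Sum.inr (Sum.inl a))) (Sum.inl (Sum.inl a)) =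
      if c₂ = c₁ then 2 * (N : ℝ) ^ 2 else 0 := by
  simp only [adM_apply, rotFam_inl, rotFam_inr_inl]
  exact sum_rntr_conj₂ hτ ho hN c₂ c₁

/-- [folklore] **`A₃`-TYPE TRACE**: the colour matrix of `ad Y₂` between the fluctuation letter and the OUTER rotated letter `[Y₁, t]`, traced:
`[c₁ = c₂]·(−2N²)`. -/
theorem sum_adM_fluct_outer {τ : C → Matrix (Fin N) (Fin N) ℂ} (hτ : Complete τ) (ho : TrOrthonormal τ) (hN : N ≠ 0)
    (y : Fin 2 → Matrix (Fin N) (Fin N) ℂ) (c₁ c₂ : C) :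
    ∑ a, adM rntr (rotFam (rotFam (gen τ) (gen τ c₂) ![]) (gen τ c₁) y) (gen τ c₂) (Sum.inl (Sum.inl a)) (Sum.inr (Sum.inl (Sum.inl a))) =
      if c₁ = c₂ then -(2 * (N : ℝ) ^ 2) else 0 := by
  simp only [adM_apply, rotFam_inl, rotFam_inr_inl]
  exact sum_rntr_conj₁ hτ ho hN c₁ c₂

/-- [folklore] **`A₄`-TYPE TRACE** (the row twin): `[c₁ = c₂]·(2N²)`. -/
theorem sum_adM_outer_fluct {τ : C → Matrix (Fin N) (Fin N) ℂ} (hτ : Complete τ) (ho : TrOrthonormal τ) (hN : N ≠ 0)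
    (y : Fin 2 → Matrix (Fin N) (Fin N) ℂ) (c₁ c₂ : C) :
    ∑ a, adM rntr (rotFam (rotFam (gen τ) (gen τ c₂) ![]) (gen τ c₁) y) (gen τ c₂) (Sum.inr (Sum.inl (Sum.inl a))) (Sum.inl (Sum.inl a)) =
      if c₁ = c₂ then 2 * (N : ℝ) ^ 2 else 0 := by
  simp only [adM_apply, rotFam_inl, rotFam_inr_inl]
  exact sum_rntr_conj₂ hτ ho hN c₁ c₂

/-! ## §3 The two curl–curl colour numbers -/

omit [Fintype C] [DecidableEq C] in
/-- [folklore] **CYCLICITY**: with the fluctuation letter outside, `rntr(A·[X,[Z,A]]) = −rntr([Z,A]·[X,A])` (products written out). -/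
theorem rntr_fluct_mul_ad_ad (A X Z : Matrix (Fin N) (Fin N) ℂ) :
    rntr (A * (X * (Z * A - A * Z) - (Z * A - A * Z) * X)) = -rntr ((Z * A - A * Z) * (X * A - A * X)) := by
  have g1 : rntr (A * X * Z * A) = rntr (Z * A * A * X) := by rw [mul_assoc (A * X) Z A, rntr_comm, ← mul_assoc]
  have g2 : rntr (A * X * A * Z) = rntr (Z * A * X * A) := by rw [rntr_comm (A * X * A) Z, ← mul_assoc, ← mul_assoc]
  have g3 : rntr (A * A * Z * X) = rntr (A * Z * X * A) := by
    rw [mul_assoc A A Z, mul_assoc A (A * Z) X, rntr_comm A (A * Z * X)]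
  simp only [mul_sub, sub_mul, map_sub, ← mul_assoc]
  rw [g1, g2, g3]
  ring

omit [Fintype C] [DecidableEq C] in
/-- [folklore] leaf-09's `rntr_mul_br_br` with the commutators written out: `rntr(X·[A,[Z,A]]) = rntr([Z,A]·[X,A])`. -/
theorem rntr_mul_ad_ad (X A Z : Matrix (Fin N) (Fin N) ℂ) :
    rntr (X * (A * (Z * A - A * Z) - (Z * A - A * Z) * A)) = rntr ((Z * A - A * Z) * (X * A - A * X)) := by
  simpa only [br] using rntr_mul_br_br X A Z

/-- [folklore] **THE `K₄` NUMBER TRACED**: `Σ_a rntr([t_{c₁},t_a]·[t_{c₂},t_a]) = [c₁ = c₂]·(−2N²)`. -/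
theorem sum_rntr_ad_mul_ad {τ : C → Matrix (Fin N) (Fin N) ℂ} (hτ : Complete τ) (ho : TrOrthonormal τ) (hN : N ≠ 0) (c₁ c₂ : C) :
    ∑ a, rntr ((gen τ c₁ * gen τ a - gen τ a * gen τ c₁) * (gen τ c₂ * gen τ a - gen τ a * gen τ c₂)) =
      if c₁ = c₂ then -(2 * (N : ℝ) ^ 2) else 0 := by
  have h := sum_rntr_conj₁ hτ ho hN c₁ c₂
  simp only [br] at h
  rw [← h]
  exact Finset.sum_congr rfl fun a _ => (rntr_mul_ad_ad (gen τ c₂) (gen τ a) (gen τ c₁)).symm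

/-- [folklore] half of the `K₃` number: `Σ_a rntr(t_a·[t_c,[t_{c′},t_a]]) = [c′ = c]·(2N²)`. -/
theorem sum_rntr_fluct_ad_ad {τ : C → Matrix (Fin N) (Fin N) ℂ} (hτ : Complete τ) (ho : TrOrthonormal τ) (hN : N ≠ 0) (c c' : C) :
    ∑ a, rntr (gen τ a * (gen τ c * (gen τ c' * gen τ a - gen τ a * gen τ c') - (gen τ c' * gen τ a - gen τ a * gen τ c') * gen τ c)) =
      if c' = c then 2 * (N : ℝ) ^ 2 else 0 := by
  simp only [rntr_fluct_mul_ad_ad, Finset.sum_neg_distrib, sum_rntr_ad_mul_ad hτ ho hN c' c]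
  split_ifs <;> ring

/-- [folklore] **THE `K₃` NUMBER TRACED**: `Σ_a rntr(t_a·(ad t_{c₁} ad t_{c₂} + ad t_{c₂} ad t_{c₁})(t_a)) = [c₁ = c₂]·(4N²)` (the summand
written out exactly as in `WilsonJetReflection2Entry.jet22_pull_quadForm`'s `K₃`). -/
theorem sum_rntr_fluct_adad_sym {τ : C → Matrix (Fin N) (Fin N) ℂ} (hτ : Complete τ) (ho : TrOrthonormal τ) (hN : N ≠ 0) (c₁ c₂ : C) :
    ∑ a, rntr (gen τ a * (gen τ c₁ * (gen τ c₂ * gen τ a - gen τ a * gen τ c₂) - (gen τ c₂ * gen τ a - gen τ a * gen τ c₂) * gen τ c₁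
        + (gen τ c₂ * (gen τ c₁ * gen τ a - gen τ a * gen τ c₁) - (gen τ c₁ * gen τ a - gen τ a * gen τ c₁) * gen τ c₂))) =
      if c₁ = c₂ then 4 * (N : ℝ) ^ 2 else 0 := by
  simp only [mul_add, map_add, Finset.sum_add_distrib, sum_rntr_fluct_ad_ad hτ ho hN]
  by_cases h : c₁ = c₂
  · subst h
    simp only [if_true]
    ring
  · have h' : ¬c₂ = c₁ := fun h'' => h h''.symm
    simp [h, h']

end Traces

/-! ## §4 The traced law -/

section Law

open scoped Matrix.Norms.Operator

variable {N : ℕ} {C : Type*} [Fintype C] [DecidableEq C]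
variable {Λ : Type*} [DecidableEq Λ] [AddCommGroup Λ] {D : Type*} [Fintype D] [DecidableEq D]

variable [Fintype Λ] {σ : Λ → Λ} {e : D → Λ} {α : D}

/-- [folklore] **THE `(2,2)` AXIS-REFLECTION LAW OF THE WILSON BI-STENCIL, TRACED, ON A FINITE LATTICE** (one background colour `c` on both
bonds; see the module docstring): `WilsonJetReflection2Entry.jet22_pull_entry_colour` at `t = gen τ`, `Y₁ = Y₂ = gen τ c`, legs `(x,(a,μ))`,
`(z,(a,ν))`, summed over the fluctuation colour `a` — the two-bond blocks are the traced tables `bondPairTab … (w22 N)` (§1), the first-order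
blocks the cut colourless stencils `wilsonStencil₀` with the conjugation numbers `∓2N²` (§2), the kinetic blocks the curl–curl cuts with `4N²`,
`−2N²` (§3). -/
theorem jet22_pull_traced {τ : C → Matrix (Fin N) (Fin N) ℂ} (hτ : Complete τ) (ho : TrOrthonormal τ) (hN : N ≠ 0) (c : C)
    (hσ : Function.Involutive σ) (h₁ : ∀ x κ, κ ≠ α → σ (x + e κ) = σ x + e κ) (h₂ : ∀ x, σ (x + e α) = σ x - e α)
    (u₁ u₂ : Λ) (κ₁ κ₂ : D) (x : Λ) (μ : D) (z : Λ) (ν : D) :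
      (4 * (sgn α κ₁ * sgn α κ₂) * (sgn α μ * sgn α ν *
          (bondPairTab e (rsite σ e α κ₁ u₁) κ₁ (rsite σ e α κ₂ u₂) κ₂ (w22 N) (rsite σ e α μ x, μ) (rsite σ e α ν z, ν)
            + bondPairTab e (rsite σ e α κ₂ u₂) κ₂ (rsite σ e α κ₁ u₁) κ₁ (w22 N) (rsite σ e α μ x, μ) (rsite σ e α ν z, ν)))
        - 4 * (bondPairTab e u₁ κ₁ u₂ κ₂ (w22 N) (x, μ) (z, ν) + bondPairTab e u₂ κ₂ u₁ κ₁ (w22 N) (x, μ) (z, ν))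
        + 4 * ((((if z = u₂ ∧ ν = α ∧ α = κ₂ then -(2 * (N : ℝ) ^ 2) * wilsonStencil₀ e u₁ κ₁ (x, μ) (z, ν) else 0)
            + if x = u₂ ∧ μ = α ∧ α = κ₂ then 2 * (N : ℝ) ^ 2 * wilsonStencil₀ e u₁ κ₁ (x, μ) (z, ν) else 0)
            + if z = u₁ ∧ ν = α ∧ α = κ₁ then -(2 * (N : ℝ) ^ 2) * wilsonStencil₀ e u₂ κ₂ (x, μ) (z, ν) else 0)
            + if x = u₁ ∧ μ = α ∧ α = κ₁ then 2 * (N : ℝ) ^ 2 * wilsonStencil₀ e u₂ κ₂ (x, μ) (z, ν) else 0)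
        - 2 * (if z = u₁ ∧ ν = α ∧ u₁ = u₂ ∧ α = κ₁ ∧ α = κ₂ then 4 * (N : ℝ) ^ 2 * curlCurl e (x, μ) (u₁, α) else 0)
        - 4 * (if (x = u₁ ∧ μ = α) ∧ (z = u₂ ∧ ν = α) ∧ α = κ₁ ∧ α = κ₂ then
            -(2 * (N : ℝ) ^ 2) * curlCurl e (u₁, α) (u₂, α) else 0))
      + (4 * (sgn α κ₁ * sgn α κ₂) * (sgn α ν * sgn α μ *
          (bondPairTab e (rsite σ e α κ₁ u₁) κ₁ (rsite σ e α κ₂ u₂) κ₂ (w22 N) (rsite σ e α ν z, ν) (rsite σ e α μ x, μ)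
            + bondPairTab e (rsite σ e α κ₂ u₂) κ₂ (rsite σ e α κ₁ u₁) κ₁ (w22 N) (rsite σ e α ν z, ν) (rsite σ e α μ x, μ)))
        - 4 * (bondPairTab e u₁ κ₁ u₂ κ₂ (w22 N) (z, ν) (x, μ) + bondPairTab e u₂ κ₂ u₁ κ₁ (w22 N) (z, ν) (x, μ))
        + 4 * ((((if x = u₂ ∧ μ = α ∧ α = κ₂ then -(2 * (N : ℝ) ^ 2) * wilsonStencil₀ e u₁ κ₁ (z, ν) (x, μ) else 0)
            + if z = u₂ ∧ ν = α ∧ α = κ₂ then 2 * (N : ℝ) ^ 2 * wilsonStencil₀ e u₁ κ₁ (z, ν) (x, μ) else 0)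
            + if x = u₁ ∧ μ = α ∧ α = κ₁ then -(2 * (N : ℝ) ^ 2) * wilsonStencil₀ e u₂ κ₂ (z, ν) (x, μ) else 0)
            + if z = u₁ ∧ ν = α ∧ α = κ₁ then 2 * (N : ℝ) ^ 2 * wilsonStencil₀ e u₂ κ₂ (z, ν) (x, μ) else 0)
        - 2 * (if x = u₁ ∧ μ = α ∧ u₁ = u₂ ∧ α = κ₁ ∧ α = κ₂ then 4 * (N : ℝ) ^ 2 * curlCurl e (z, ν) (u₁, α) else 0)
        - 4 * (if (z = u₁ ∧ ν = α) ∧ (x = u₂ ∧ μ = α) ∧ α = κ₁ ∧ α = κ₂ then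
            -(2 * (N : ℝ) ^ 2) * curlCurl e (u₁, α) (u₂, α) else 0)) = 0 := by
  -- the entrywise law with colour at `Y₁ = Y₂ = gen τ c`, summed over the fluctuation colour diagonal
  have h := fun a : C =>
    jet22_pull_entry_colour rntr rntr_comm hσ h₁ h₂ (gen τ) (gen τ c) (gen τ c) u₁ u₂ κ₁ κ₂ (x, (a, μ)) (z, (a, ν))
  simp only [Matrix.of_apply, Matrix.add_apply] at h
  have hs := Finset.sum_eq_zero fun (a : C) (_ : a ∈ (Finset.univ : Finset C)) => h a
  -- trace every block (§1–§3)
  simp only [Finset.sum_add_distrib, Finset.sum_sub_distrib, ← Finset.mul_sum, Finset.sum_ite_irrel, Finset.sum_const_zero,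
    wilsonVertex₁_apply_eq_mul, ← Finset.sum_mul, sum_wilsonVertex₂_dspare₀₁_diag hτ ho hN, sum_wilsonVertex₂_dspare₁₀_diag hτ ho hN,
    sum_adM_fluct_inner hτ ho hN, sum_adM_inner_fluct hτ ho hN, sum_adM_fluct_outer hτ ho hN, sum_adM_outer_fluct hτ ho hN,
    sum_rntr_fluct_adad_sym hτ ho hN, sum_rntr_ad_mul_ad hτ ho hN, if_true] at hs
  exact hs

/-! ## §5 The traced law in the packed currency `wsym22` / `S₀A` -/

/-- [folklore] **THE `(2,2)` AXIS-REFLECTION LAW FOR THE TABLE `wsym22 N` ON A FINITE LATTICE — REFLECTED TABLE = TABLE + CONTACT TERMS**: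
with `ûᵢ := rsite σ e α κᵢ uᵢ`, `ρ̄x := rsite σ e α μ x`, `ρ̄z := rsite σ e α ν z`,
`sgn α κ₁·sgn α κ₂·(sgn α μ·sgn α ν)·BPT e û₁ κ₁ û₂ κ₂ (wsym22 N) (ρ̄x,μ) (ρ̄z,ν)`
`  − BPT e u₁ κ₁ u₂ κ₂ (wsym22 N) (x,μ) (z,ν)`
`  + 4N²·([x=u₂∧μ=α∧α=κ₂] − [z=u₂∧ν=α∧α=κ₂])·S₀A e u₁ κ₁ (x,μ) (z,ν)`
`  + 4N²·([x=u₁∧μ=α∧α=κ₁] − [z=u₁∧ν=α∧α=κ₁])·S₀A e u₂ κ₂ (x,μ) (z,ν)`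
`  − 2N²·([z=u₁∧ν=α∧u₁=u₂∧α=κ₁∧α=κ₂]·curlCurl e (x,μ) (u₁,α) + [x=u₁∧μ=α∧…]·curlCurl e (z,ν) (u₁,α))`
`  + 2N²·([(x,μ)=(u₁,α)∧(z,ν)=(u₂,α)∧α=κ₁∧α=κ₂] + [(z,ν)=(u₁,α)∧(x,μ)=(u₂,α)∧…])·curlCurl e (u₁,α) (u₂,α) = 0`
(§4 ÷ 4; cuts kept as `if … then … else 0`). -/
theorem jet22_pull_traced_wsym22 {τ : C → Matrix (Fin N) (Fin N) ℂ} (hτ : Complete τ) (ho : TrOrthonormal τ) (hN : N ≠ 0) (c : C)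
    (hσ : Function.Involutive σ) (h₁ : ∀ x κ, κ ≠ α → σ (x + e κ) = σ x + e κ) (h₂ : ∀ x, σ (x + e α) = σ x - e α)
    (u₁ u₂ : Λ) (κ₁ κ₂ : D) (x : Λ) (μ : D) (z : Λ) (ν : D) :
    sgn α κ₁ * sgn α κ₂ * (sgn α μ * sgn α ν) *
          bondPairTab e (rsite σ e α κ₁ u₁) κ₁ (rsite σ e α κ₂ u₂) κ₂ (wsym22 N) (rsite σ e α μ x, μ) (rsite σ e α ν z, ν)
        - bondPairTab e u₁ κ₁ u₂ κ₂ (wsym22 N) (x, μ) (z, ν)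
        + 4 * (N : ℝ) ^ 2 * ((if x = u₂ ∧ μ = α ∧ α = κ₂ then S₀A e u₁ κ₁ (x, μ) (z, ν) else 0)
            - (if z = u₂ ∧ ν = α ∧ α = κ₂ then S₀A e u₁ κ₁ (x, μ) (z, ν) else 0)
            + (if x = u₁ ∧ μ = α ∧ α = κ₁ then S₀A e u₂ κ₂ (x, μ) (z, ν) else 0)
            - (if z = u₁ ∧ ν = α ∧ α = κ₁ then S₀A e u₂ κ₂ (x, μ) (z, ν) else 0))
        - 2 * (N : ℝ) ^ 2 * ((if z = u₁ ∧ ν = α ∧ u₁ = u₂ ∧ α = κ₁ ∧ α = κ₂ then curlCurl e (x, μ) (u₁, α) else 0)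
            + (if x = u₁ ∧ μ = α ∧ u₁ = u₂ ∧ α = κ₁ ∧ α = κ₂ then curlCurl e (z, ν) (u₁, α) else 0))
        + 2 * (N : ℝ) ^ 2 * ((if (x = u₁ ∧ μ = α) ∧ (z = u₂ ∧ ν = α) ∧ α = κ₁ ∧ α = κ₂ then curlCurl e (u₁, α) (u₂, α) else 0)
            + (if (z = u₁ ∧ ν = α) ∧ (x = u₂ ∧ μ = α) ∧ α = κ₁ ∧ α = κ₂ then curlCurl e (u₁, α) (u₂, α) else 0)) = 0 := by
  have h := jet22_pull_traced hτ ho hN c hσ h₁ h₂ u₁ u₂ κ₁ κ₂ x μ z ν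
  -- the two four-term symmetrisations are the tables of `wsym22 N`
  have e₁ := bondPairTab_fourTerm e (rsite σ e α κ₁ u₁) κ₁ (rsite σ e α κ₂ u₂) κ₂ (w22 N) (rsite σ e α μ x, μ) (rsite σ e α ν z, ν)
  have e₂ := bondPairTab_fourTerm e u₁ κ₁ u₂ κ₂ (w22 N) (x, μ) (z, ν)
  rw [bondPairTab_symTab_swap, symTab_w22] at e₁ e₂
  -- the first-order cuts pair into `S₀A`
  have a₁ : (if z = u₂ ∧ ν = α ∧ α = κ₂ then -(2 * (N : ℝ) ^ 2) * wilsonStencil₀ e u₁ κ₁ (x, μ) (z, ν) else 0)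
      + (if z = u₂ ∧ ν = α ∧ α = κ₂ then 2 * (N : ℝ) ^ 2 * wilsonStencil₀ e u₁ κ₁ (z, ν) (x, μ) else 0) =
      -(4 * (N : ℝ) ^ 2) * (if z = u₂ ∧ ν = α ∧ α = κ₂ then S₀A e u₁ κ₁ (x, μ) (z, ν) else 0) := by
    simp only [S₀A]; split_ifs <;> ring
  have a₂ : (if x = u₂ ∧ μ = α ∧ α = κ₂ then 2 * (N : ℝ) ^ 2 * wilsonStencil₀ e u₁ κ₁ (x, μ) (z, ν) else 0)
      + (if x = u₂ ∧ μ = α ∧ α = κ₂ then -(2 * (N : ℝ) ^ 2) * wilsonStencil₀ e u₁ κ₁ (z, ν) (x, μ) else 0) =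
      4 * (N : ℝ) ^ 2 * (if x = u₂ ∧ μ = α ∧ α = κ₂ then S₀A e u₁ κ₁ (x, μ) (z, ν) else 0) := by
    simp only [S₀A]; split_ifs <;> ring
  have a₃ : (if z = u₁ ∧ ν = α ∧ α = κ₁ then -(2 * (N : ℝ) ^ 2) * wilsonStencil₀ e u₂ κ₂ (x, μ) (z, ν) else 0)
      + (if z = u₁ ∧ ν = α ∧ α = κ₁ then 2 * (N : ℝ) ^ 2 * wilsonStencil₀ e u₂ κ₂ (z, ν) (x, μ) else 0) =
      -(4 * (N : ℝ) ^ 2) * (if z = u₁ ∧ ν = α ∧ α = κ₁ then S₀A e u₂ κ₂ (x, μ) (z, ν) else 0) := by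
    simp only [S₀A]; split_ifs <;> ring
  have a₄ : (if x = u₁ ∧ μ = α ∧ α = κ₁ then 2 * (N : ℝ) ^ 2 * wilsonStencil₀ e u₂ κ₂ (x, μ) (z, ν) else 0)
      + (if x = u₁ ∧ μ = α ∧ α = κ₁ then -(2 * (N : ℝ) ^ 2) * wilsonStencil₀ e u₂ κ₂ (z, ν) (x, μ) else 0) =
      4 * (N : ℝ) ^ 2 * (if x = u₁ ∧ μ = α ∧ α = κ₁ then S₀A e u₂ κ₂ (x, μ) (z, ν) else 0) := by
    simp only [S₀A]; split_ifs <;> ring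
  -- constants out of the kinetic cuts
  have k₁ : (if z = u₁ ∧ ν = α ∧ u₁ = u₂ ∧ α = κ₁ ∧ α = κ₂ then 4 * (N : ℝ) ^ 2 * curlCurl e (x, μ) (u₁, α) else 0) =
      4 * (N : ℝ) ^ 2 * (if z = u₁ ∧ ν = α ∧ u₁ = u₂ ∧ α = κ₁ ∧ α = κ₂ then curlCurl e (x, μ) (u₁, α) else 0) := by
    split_ifs <;> ring
  have k₂ : (if x = u₁ ∧ μ = α ∧ u₁ = u₂ ∧ α = κ₁ ∧ α = κ₂ then 4 * (N : ℝ) ^ 2 * curlCurl e (z, ν) (u₁, α) else 0) =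
      4 * (N : ℝ) ^ 2 * (if x = u₁ ∧ μ = α ∧ u₁ = u₂ ∧ α = κ₁ ∧ α = κ₂ then curlCurl e (z, ν) (u₁, α) else 0) := by
    split_ifs <;> ring
  have q₁ : (if (x = u₁ ∧ μ = α) ∧ (z = u₂ ∧ ν = α) ∧ α = κ₁ ∧ α = κ₂ then
        -(2 * (N : ℝ) ^ 2) * curlCurl e (u₁, α) (u₂, α) else 0) =
      -(2 * (N : ℝ) ^ 2) * (if (x = u₁ ∧ μ = α) ∧ (z = u₂ ∧ ν = α) ∧ α = κ₁ ∧ α = κ₂ then curlCurl e (u₁, α) (u₂, α) else 0) := by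
    split_ifs <;> ring
  have q₂ : (if (z = u₁ ∧ ν = α) ∧ (x = u₂ ∧ μ = α) ∧ α = κ₁ ∧ α = κ₂ then
        -(2 * (N : ℝ) ^ 2) * curlCurl e (u₁, α) (u₂, α) else 0) =
      -(2 * (N : ℝ) ^ 2) * (if (z = u₁ ∧ ν = α) ∧ (x = u₂ ∧ μ = α) ∧ α = κ₁ ∧ α = κ₂ then curlCurl e (u₁, α) (u₂, α) else 0) := by
    split_ifs <;> ring
  linear_combination (1 / 4 : ℝ) * h - (sgn α κ₁ * sgn α κ₂ * (sgn α μ * sgn α ν)) * e₁ + e₂ - a₁ - a₂ - a₃ - a₄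
    + (1 / 2 : ℝ) * k₁ + (1 / 2 : ℝ) * k₂ + q₁ + q₂

end Law

end Summit.QuantumFields.BalabanUV.Beta.WilsonJetReflection2Trace
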